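import Mathlib
import Summits.ValiantsHypothesis.ValiantsHypothesis.Theorems.ZeroOneTransfer.Negative.TopComponentFree
import Literature.Computability.AlgebraicComplexity.NestFreeMatchingPoly
import Literature.Computability.AlgebraicComplexity.IMMInVPProofs
import HarnessLib

/-!
# Route FifoMatching — crux `NNLowDegreeCofactorHard` (stmt-ValiantsHypothesis-22993), line `freed_vertices`:
# preliminaries for stub S2 `stub_carveInterval` — monomial substitutions over `ℝ≥0` and the
# restriction / extension of nest-free matchings along an interval

Registered line `Cruxes/NNLowDegreeCofactorHard/Lines/freed_vertices.lean` (tenure g6, 2026-08-27).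
This file is the toolkit of `Theorems/FifoMatchingNNLowDegreeCofactorHardCarveInterval.lean` (S2):

* §1 MONOMIAL SUBSTITUTIONS OVER `ℝ≥0`: for `x_e ↦ x^(u e)` the support of the image is the image of
  the support under the `ℕ`-linear exponent map `linExp u` (`support_aeval_monomial`; no
  cancellation), and such a substitution is free when every `x^(u e)` is `1` or a variable
  (`complexity_aeval_le_of_free'`);
* §2 the support of the top total-degree component (`topComponent (fun _ => 1)` of
  `ZeroOneTransfer/Negative/TopComponentFree.lean`);
* §3 an interval `I = [a, a + 2n') ⊆ [2n]`: the order embedding `shiftIn`, the restriction `restrictI`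
  to `I` of a matching mapping `I` into `I` (again nest-free perfect, `restrictI_mem_nestFreeMatchings`)
  and the extension `extendI` of a matching of `I ≅ [2n']` by the consecutive pairs `(2t, 2t+1)`
  outside `I` — for even `a` a nest-free perfect matching of `[2n]` (`extendI_mem_nestFreeMatchings`:
  an outside pair nests with nothing and an arc inside the interval cannot surround an outside
  vertex), with `restrictI ∘ extendI = id`.

Honest framing: combinatorial plumbing for a stub of an OPEN crux on a conditional route; nothing here
bears on `VP ≠ VNP` (NOT proved).  Definitions: `linExp`, `shiftIn`, `restrictI`, `extendI`
(bookkeeping); no named facts.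
-/

noncomputable section

-- Sub = Summit single-conjunct layout: the duplicated namespace component is mandated by the tree.
set_option linter.dupNamespace false

namespace Summit.ValiantsHypothesis.ValiantsHypothesis.Theorems.FifoMatching.NNLowDegreeCofactorHard

open MvPolynomial Finset Literature.Computability.AlgebraicComplexity
open Summit.ValiantsHypothesis.ValiantsHypothesis.Theorems.ZeroOneTransfer.Negative
open scoped NNReal

/-! ### §1 Monomial substitutions over `ℝ≥0`: supports are all that matters -/

section MonomialSubst

variable {σ τ : Type*}

/-- Over `ℝ≥0` (no cancellation) a sum of monomials with nonzero coefficients has support the set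
of its exponents. [folklore] -/
theorem support_sum_monomial_eq_image [DecidableEq τ] {ι : Type*} (S : Finset ι) (F : ι → τ →₀ ℕ)
    (c : ι → ℝ≥0) (hc : ∀ i ∈ S, c i ≠ 0) :
    (∑ i ∈ S, monomial (F i) (c i)).support = S.image F := by
  classical
  ext x
  rw [mem_support_iff, coeff_sum, Finset.mem_image]
  simp only [coeff_monomial]
  rw [← Finset.sum_filter]
  constructor
  · intro h
    by_contra hno
    apply h
    refine Finset.sum_eq_zero fun i hi => ?_
    exact absurd ⟨i, (Finset.mem_filter.1 hi).1, (Finset.mem_filter.1 hi).2⟩ hno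
  · rintro ⟨i, hi, hFi⟩
    have hmem : i ∈ S.filter (fun i => F i = x) := Finset.mem_filter.2 ⟨hi, hFi⟩
    have hle := Finset.single_le_sum (f := fun i => c i) (fun _ _ => zero_le) hmem
    exact (lt_of_lt_of_le (pos_iff_ne_zero.2 (hc i hi)) hle).ne'

/-- The exponent map of the monomial substitution `x_e ↦ x^(u e)`: the `ℕ`-linear map
`d ↦ Σ_e d(e) · u(e)` (`Finsupp.linearCombination`). [folklore] -/
def linExp (u : σ → τ →₀ ℕ) : (σ →₀ ℕ) →ₗ[ℕ] (τ →₀ ℕ) := Finsupp.linearCombination ℕ u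

/-- `linExp` on a unit vector. [folklore] -/
@[simp] theorem linExp_single (u : σ → τ →₀ ℕ) (e : σ) (k : ℕ) :
    linExp u (Finsupp.single e k) = k • u e := by
  unfold linExp
  exact Finsupp.linearCombination_single ℕ k e

/-- `linExp` of a sum of unit vectors. [folklore] -/
theorem linExp_sum_single {ι : Type*} (u : σ → τ →₀ ℕ) (S : Finset ι) (f : ι → σ) :
    linExp u (∑ i ∈ S, Finsupp.single (f i) 1) = ∑ i ∈ S, u (f i) := by
  rw [map_sum]
  exact Finset.sum_congr rfl fun i _ => by rw [linExp_single, one_smul]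

/-- A monomial substitution `x_e ↦ x^(u e)` maps the monomial `c·x^d` to `c·x^(linExp u d)`.
[folklore] -/
theorem aeval_monomial_monomial (u : σ → τ →₀ ℕ) (d : σ →₀ ℕ) (c : ℝ≥0) :
    aeval (fun e => (monomial (u e) (1 : ℝ≥0) : MvPolynomial τ ℝ≥0)) (monomial d c) =
      monomial (linExp u d) c := by
  classical
  rw [aeval_monomial, ← C_eq_algebraMap]
  have : (d.prod fun e k => (monomial (u e) (1 : ℝ≥0) : MvPolynomial τ ℝ≥0) ^ k) =
      monomial (linExp u d) 1 := by
    unfold linExp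
    rw [Finsupp.linearCombination_apply, Finsupp.prod, Finsupp.sum, monomial_sum_one]
    refine Finset.prod_congr rfl fun e _ => ?_
    rw [monomial_pow, one_pow]
  rw [this, C_mul_monomial, mul_one]

/-- **Support of a monomial substitution over `ℝ≥0`**: `supp (q[x_e ↦ x^(u e)]) = linExp u '' supp q`.
[folklore] -/
theorem support_aeval_monomial [DecidableEq τ] (u : σ → τ →₀ ℕ) (q : MvPolynomial σ ℝ≥0) :
    (aeval (fun e => (monomial (u e) (1 : ℝ≥0) : MvPolynomial τ ℝ≥0)) q).support =
      q.support.image (linExp u) := by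
  classical
  conv_lhs => rw [q.as_sum, map_sum]
  simp only [aeval_monomial_monomial]
  exact support_sum_monomial_eq_image _ _ _ fun d hd => mem_support_iff.1 hd

/-- A monomial substitution costs nothing when every `x^(u e)` is free (a variable or `1`).
[folklore] -/
theorem complexity_aeval_le_of_free' [Fintype σ] (g : σ → MvPolynomial τ ℝ≥0)
    (hg : ∀ i, complexity (g i) = 0) (p : MvPolynomial σ ℝ≥0) :
    complexity (aeval g p) ≤ complexity p := by
  refine (complexity_aeval_le _ _).trans ?_
  simp only [hg, Finset.sum_const_zero, add_zero, le_refl]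

/-- `x^0 = 1` and `x^(single t 1) = x_t` are free inputs. [folklore] -/
theorem complexity_monomial_one_eq_zero_of (s : τ →₀ ℕ) (hs : s = 0 ∨ ∃ t, s = Finsupp.single t 1) :
    complexity (monomial s (1 : ℝ≥0) : MvPolynomial τ ℝ≥0) = 0 := by
  rcases hs with rfl | ⟨t, rfl⟩
  · rw [monomial_zero']
    exact complexity_C_holds _
  · change complexity (X t : MvPolynomial τ ℝ≥0) = 0
    exact complexity_X_holds _

end MonomialSubst

/-! ### §2 The support of a top degree component -/

section TopDegree

variable {τ : Type*}

/-- Membership in the support of the top (total-degree) component. [folklore] -/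
theorem mem_support_topComponent_one_iff (p : MvPolynomial τ ℝ≥0) (x : τ →₀ ℕ) :
    x ∈ (topComponent (fun _ => 1) p).support ↔
      x ∈ p.support ∧ x.degree = weightedTotalDegree (fun _ : τ => (1 : ℕ)) p := by
  classical
  rw [mem_support_iff, coeff_topComponent, Finsupp.degree_eq_weight_one]
  constructor
  · intro h
    by_cases hx : Finsupp.weight (fun _ : τ => 1) x = weightedTotalDegree (fun _ : τ => (1 : ℕ)) p
    · rw [if_pos hx] at h; exact ⟨mem_support_iff.2 h, hx⟩
    · rw [if_neg hx] at h; exact absurd rfl h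
  · rintro ⟨hx, hw⟩
    rw [if_pos hw]; exact mem_support_iff.1 hx

/-- The top total degree is the maximum of the degrees over the support: if every monomial has
degree `≤ D` and one has degree `D`, it is `D`. [folklore] -/
theorem weightedTotalDegree_one_eq {p : MvPolynomial τ ℝ≥0} {D : ℕ}
    (hle : ∀ x ∈ p.support, x.degree ≤ D) (hex : ∃ x ∈ p.support, x.degree = D) :
    weightedTotalDegree (fun _ : τ => (1 : ℕ)) p = D := by
  classical
  apply le_antisymm
  · rw [weightedTotalDegree]
    refine Finset.sup_le fun x hx => ?_
    rw [← Finsupp.degree_eq_weight_one]; exact hle x hx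
  · obtain ⟨x, hx, hD⟩ := hex
    rw [← hD, Finsupp.degree_eq_weight_one, weightedTotalDegree]
    exact Finset.le_sup hx

end TopDegree


/-! ### §3 An interval `I = [a, a + 2n')` of `Fin (2n)`: restriction and extension of matchings -/

section Interval

variable {n n' a : ℕ}

/-- The order embedding `k ↦ a + k` of `Fin (2n')` onto the interval `I = [a, a + 2n')`. [folklore] -/
def shiftIn (hI : a + 2 * n' ≤ 2 * n) (k : Fin (2 * n')) : Fin (2 * n) := ⟨a + k, by omega⟩

/-- Value of the interval embedding. [folklore] -/
@[simp] theorem shiftIn_val (hI : a + 2 * n' ≤ 2 * n) (k : Fin (2 * n')) :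
    ((shiftIn hI k : Fin (2 * n)) : ℕ) = a + k := rfl

/-- The interval embedding is injective. [folklore] -/
theorem shiftIn_injective (hI : a + 2 * n' ≤ 2 * n) : Function.Injective (shiftIn hI) := by
  intro k l h
  have := congrArg Fin.val h
  simp only [shiftIn_val] at this
  exact Fin.ext (by omega)

/-- Restriction to `I` (read in `Fin (2n')`) of a self-map `M` of `Fin (2n)`; meaningful when
`M(I) ⊆ I` (junk value `k` otherwise). [folklore] -/
def restrictI (hI : a + 2 * n' ≤ 2 * n) (M : Fin (2 * n) → Fin (2 * n)) (k : Fin (2 * n')) :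
    Fin (2 * n') :=
  if h : a ≤ (M (shiftIn hI k) : ℕ) ∧ (M (shiftIn hI k) : ℕ) < a + 2 * n'
  then ⟨(M (shiftIn hI k) : ℕ) - a, by omega⟩ else k

/-- Value of the restriction when `M` maps `I` into `I`. [folklore] -/
theorem restrictI_val (hI : a + 2 * n' ≤ 2 * n) {M : Fin (2 * n) → Fin (2 * n)}
    (hMI : ∀ v : Fin (2 * n), a ≤ (v : ℕ) ∧ (v : ℕ) < a + 2 * n' →
      a ≤ (M v : ℕ) ∧ (M v : ℕ) < a + 2 * n') (k : Fin (2 * n')) :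
    ((restrictI hI M k : Fin (2 * n')) : ℕ) = (M (shiftIn hI k) : ℕ) - a := by
  have h := hMI (shiftIn hI k) ⟨by simp, by simp⟩
  unfold restrictI
  rw [dif_pos h]

/-- The restriction, read back in `[2n]`, is `M` on the interval. [folklore] -/
theorem shiftIn_restrictI (hI : a + 2 * n' ≤ 2 * n) {M : Fin (2 * n) → Fin (2 * n)}
    (hMI : ∀ v : Fin (2 * n), a ≤ (v : ℕ) ∧ (v : ℕ) < a + 2 * n' →
      a ≤ (M v : ℕ) ∧ (M v : ℕ) < a + 2 * n') (k : Fin (2 * n')) :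
    shiftIn hI (restrictI hI M k) = M (shiftIn hI k) := by
  have h := hMI (shiftIn hI k) ⟨by simp, by simp⟩
  apply Fin.ext
  rw [shiftIn_val, restrictI_val hI hMI]
  omega

/-- The restriction of a nest-free perfect matching mapping `I` into `I` is a nest-free perfect
matching of `Fin (2n')`. [folklore] -/
theorem restrictI_mem_nestFreeMatchings (hI : a + 2 * n' ≤ 2 * n) {M : Fin (2 * n) → Fin (2 * n)}
    (hM : M ∈ nestFreeMatchings (2 * n))
    (hMI : ∀ v : Fin (2 * n), a ≤ (v : ℕ) ∧ (v : ℕ) < a + 2 * n' →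
      a ≤ (M v : ℕ) ∧ (M v : ℕ) < a + 2 * n') :
    restrictI hI M ∈ nestFreeMatchings (2 * n') := by
  obtain ⟨hpm, hnest⟩ := mem_nestFreeMatchings.1 hM
  obtain ⟨hinv, hfp⟩ := mem_perfectMatchings.1 hpm
  have hval := restrictI_val hI hMI
  have hsh := shiftIn_restrictI hI hMI
  rw [mem_nestFreeMatchings, mem_perfectMatchings]
  refine ⟨⟨fun k => ?_, fun k => ?_⟩, fun i j hij hj hji => ?_⟩
  · apply shiftIn_injective hI
    rw [hsh, hsh, hinv]
  · intro h
    have := congrArg (shiftIn hI) h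
    rw [hsh] at this
    exact hfp _ this
  · -- a nesting of the restriction is a nesting of `M` inside `I`
    have h1 : shiftIn hI i < shiftIn hI j := by
      rw [Fin.lt_def, shiftIn_val, shiftIn_val]; exact Nat.add_lt_add_left hij a
    have h2 : shiftIn hI j < M (shiftIn hI j) := by
      rw [← hsh, Fin.lt_def, shiftIn_val, shiftIn_val]; exact Nat.add_lt_add_left hj a
    have h3 : M (shiftIn hI j) < M (shiftIn hI i) := by
      rw [← hsh, ← hsh, Fin.lt_def, shiftIn_val, shiftIn_val]; exact Nat.add_lt_add_left hji a
    exact hnest _ _ h1 h2 h3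

/-- Extension of a self-map `N` of `Fin (2n')` (read on `I`) to `Fin (2n)` by the consecutive
pairs `(2t, 2t+1)` outside `I` (for even `a`, both outer sides have even size). [folklore] -/
def extendI (hI : a + 2 * n' ≤ 2 * n) (N : Fin (2 * n') → Fin (2 * n')) (v : Fin (2 * n)) :
    Fin (2 * n) :=
  if h : a ≤ (v : ℕ) ∧ (v : ℕ) < a + 2 * n' then shiftIn hI (N ⟨(v : ℕ) - a, by omega⟩)
  else ⟨if (v : ℕ) % 2 = 0 then (v : ℕ) + 1 else (v : ℕ) - 1, by
    have := v.isLt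
    split_ifs <;> omega⟩

/-- On the interval the extension is (the shift of) `N`. [folklore] -/
theorem extendI_apply_shiftIn (hI : a + 2 * n' ≤ 2 * n) (N : Fin (2 * n') → Fin (2 * n'))
    (k : Fin (2 * n')) : extendI hI N (shiftIn hI k) = shiftIn hI (N k) := by
  unfold extendI
  rw [dif_pos ⟨by simp, by simp⟩]
  congr 2
  apply Fin.ext
  simp

/-- Outside the interval the extension pairs `2t ↔ 2t+1`. [folklore] -/
theorem extendI_val_of_not (hI : a + 2 * n' ≤ 2 * n) (N : Fin (2 * n') → Fin (2 * n'))
    {v : Fin (2 * n)} (hv : ¬ (a ≤ (v : ℕ) ∧ (v : ℕ) < a + 2 * n')) :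
    ((extendI hI N v : Fin (2 * n)) : ℕ) = if (v : ℕ) % 2 = 0 then (v : ℕ) + 1 else (v : ℕ) - 1 := by
  unfold extendI
  rw [dif_neg hv]

/-- A vertex of the interval is a shifted point, mapped to the shift of its `N`-partner. [folklore] -/
theorem extendI_val_of_mem (hI : a + 2 * n' ≤ 2 * n) (N : Fin (2 * n') → Fin (2 * n'))
    {v : Fin (2 * n)} (hv : a ≤ (v : ℕ) ∧ (v : ℕ) < a + 2 * n') :
    ∃ k : Fin (2 * n'), v = shiftIn hI k ∧ extendI hI N v = shiftIn hI (N k) := by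
  refine ⟨⟨(v : ℕ) - a, by omega⟩, Fin.ext (by simp; omega), ?_⟩
  unfold extendI
  rw [dif_pos hv]

/-- The extension maps `I` into `I`. [folklore] -/
theorem extendI_mapsTo (hI : a + 2 * n' ≤ 2 * n) (N : Fin (2 * n') → Fin (2 * n'))
    (v : Fin (2 * n)) (hv : a ≤ (v : ℕ) ∧ (v : ℕ) < a + 2 * n') :
    a ≤ (extendI hI N v : ℕ) ∧ (extendI hI N v : ℕ) < a + 2 * n' := by
  obtain ⟨k, rfl, hk⟩ := extendI_val_of_mem hI N hv
  rw [hk, shiftIn_val]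
  constructor <;> omega

/-- Restricting the extension gives back `N`. [folklore] -/
theorem restrictI_extendI (hI : a + 2 * n' ≤ 2 * n) (N : Fin (2 * n') → Fin (2 * n')) :
    restrictI hI (extendI hI N) = N := by
  funext k
  apply shiftIn_injective hI
  rw [shiftIn_restrictI hI (extendI_mapsTo hI N), extendI_apply_shiftIn]

/-- **The extension of a nest-free perfect matching of `Fin (2n')` by consecutive outside pairs is a
nest-free perfect matching of `Fin (2n)`** (`a` even): an outside pair `(2t, 2t+1)` nests with
nothing, and an arc inside the interval `I` cannot surround a vertex outside `I`. [folklore] -/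
theorem extendI_mem_nestFreeMatchings (hI : a + 2 * n' ≤ 2 * n) (ha : Even a)
    {N : Fin (2 * n') → Fin (2 * n')} (hN : N ∈ nestFreeMatchings (2 * n')) :
    extendI hI N ∈ nestFreeMatchings (2 * n) := by
  obtain ⟨hpm, hnest⟩ := mem_nestFreeMatchings.1 hN
  obtain ⟨hinv, hfp⟩ := mem_perfectMatchings.1 hpm
  obtain ⟨t, ht⟩ := ha
  set M := extendI hI N with hMdef
  -- values
  have hin : ∀ v : Fin (2 * n), a ≤ (v : ℕ) ∧ (v : ℕ) < a + 2 * n' →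
      ∃ k : Fin (2 * n'), v = shiftIn hI k ∧ M v = shiftIn hI (N k) := fun v hv =>
    extendI_val_of_mem hI N hv
  have hout : ∀ v : Fin (2 * n), ¬ (a ≤ (v : ℕ) ∧ (v : ℕ) < a + 2 * n') →
      ((M v : Fin (2 * n)) : ℕ) = if (v : ℕ) % 2 = 0 then (v : ℕ) + 1 else (v : ℕ) - 1 :=
    fun v hv => extendI_val_of_not hI N hv
  -- outside stays outside and `M v ≤ v + 1`, with `M v = v + 1` only for even `v`
  have hout' : ∀ v : Fin (2 * n), ¬ (a ≤ (v : ℕ) ∧ (v : ℕ) < a + 2 * n') →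
      ¬ (a ≤ (M v : ℕ) ∧ (M v : ℕ) < a + 2 * n') ∧ (M v : ℕ) ≤ (v : ℕ) + 1 ∧
        ((v : ℕ) < (M v : ℕ) → (M v : ℕ) = (v : ℕ) + 1) ∧ M (M v) = v ∧ M v ≠ v := by
    intro v hv
    have h1 := hout v hv
    have hMv_out : ¬ (a ≤ (M v : ℕ) ∧ (M v : ℕ) < a + 2 * n') := by
      rw [h1]; split_ifs with hpar <;> omega
    have h2 := hout (M v) hMv_out
    refine ⟨hMv_out, ?_, ?_, ?_, ?_⟩
    · rw [h1]; split_ifs <;> omega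
    · intro hlt; rw [h1] at hlt ⊢; split_ifs at hlt ⊢ with hpar <;> omega
    · apply Fin.ext; rw [h2, h1]; split_ifs with hp1 hp2 hp3 <;> omega
    · intro he; have := congrArg Fin.val he; rw [h1] at this; split_ifs at this <;> omega
  rw [mem_nestFreeMatchings, mem_perfectMatchings]
  refine ⟨⟨fun v => ?_, fun v => ?_⟩, fun i j hij hj hji => ?_⟩
  · -- involution
    by_cases hv : a ≤ (v : ℕ) ∧ (v : ℕ) < a + 2 * n'
    · obtain ⟨k, rfl, hk⟩ := hin v hv
      rw [hk, hMdef, extendI_apply_shiftIn, hinv]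
    · exact (hout' v hv).2.2.2.1
  · -- no fixed point
    by_cases hv : a ≤ (v : ℕ) ∧ (v : ℕ) < a + 2 * n'
    · obtain ⟨k, rfl, hk⟩ := hin v hv
      rw [hk]
      exact fun h => hfp k (shiftIn_injective hI h)
    · exact (hout' v hv).2.2.2.2
  · -- nest-freeness: `i < j < M j < M i`
    by_cases hjI : a ≤ (j : ℕ) ∧ (j : ℕ) < a + 2 * n'
    · obtain ⟨l, rfl, hl⟩ := hin j hjI
      by_cases hiI : a ≤ (i : ℕ) ∧ (i : ℕ) < a + 2 * n'
      · obtain ⟨k, rfl, hk⟩ := hin _ hiI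
        rw [hl, hk] at hji; rw [hl] at hj
        rw [Fin.lt_def, shiftIn_val, shiftIn_val] at hij hj hji
        exact hnest k l (Fin.lt_def.2 (by omega)) (Fin.lt_def.2 (by omega))
          (Fin.lt_def.2 (by omega))
      · -- `i` outside, `j` inside: `M i ≤ i + 1 ≤ j < M j`
        have h := (hout' i hiI).2.1
        rw [Fin.lt_def] at hij hj hji
        omega
    · -- `j` outside: `M j = j + 1`, so `M i > j + 1 > j > i`
      obtain ⟨-, -, hstep, -, -⟩ := hout' j hjI
      have hMj : ((M j : Fin (2 * n)) : ℕ) = (j : ℕ) + 1 := hstep (Fin.lt_def.1 hj)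
      rw [Fin.lt_def] at hij hji
      by_cases hiI : a ≤ (i : ℕ) ∧ (i : ℕ) < a + 2 * n'
      · obtain ⟨k, rfl, hk⟩ := hin _ hiI
        -- `M i ∈ I`, `i ∈ I`, `i < j`, `j ∉ I` ⇒ `j ≥ a + 2n' > M i`
        have hMi : ((M (shiftIn hI k) : Fin (2 * n)) : ℕ) < a + 2 * n' := by rw [hk]; simp
        simp only [shiftIn_val] at hij
        omega
      · have h := (hout' i hiI).2.1
        omega

end Interval

end Summit.ValiantsHypothesis.ValiantsHypothesis.Theorems.FifoMatching.NNLowDegreeCofactorHard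

end
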